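import Summits.QuantumFields.YangMills.Theorems.FradkinShenkerFlowFiniteSusceptibilityWeakCouplingMirrorMonotone
import HarnessLib

/-!
# STUB 0 of line `purity-rate-split` is absence of long-range order in the iterated-limit sense (item stmt-QuantumFields-9442)

Support file for item stmt-QuantumFields-9442 (route `FradkinShenkerFlow` of `YangMills`), crux
`Summit.QuantumFields.YangMills.Theses.FradkinShenkerFlow.FiniteSusceptibilityWeakCoupling`, line `purity-rate-split`. Its STUB 0
(`stub_noMirrorLongRangeOrder`, certified necessary for the crux by `…MirrorMonotone.lean`) asks for mirror decorrelation UNIFORMLY in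
the pair (volume, lag): `∀ ε ∃ j₀ ∀ S ∀ j, j₀ ≤ j ≤ S → |D_A^{(S)}(j)| ≤ ε`, `D_A^{(S)}(j) = ⟨A · τ_{j e₀}(A∘Θ)⟩_{β,2S+1} − ⟨A⟩⟨A∘Θ⟩`.
Reflection positivity makes the symmetrised mirror function `E_A^{(S)}(m) = D_A^{(S)}(m) + D_{Aᴿ}^{(S)}(m)` NON-INCREASING in the lag on
`[2R+1, S]` (`…MirrorLogConvex`, `…MirrorMonotone`), so a single large lag controls all larger ones. Consequence proved here: at every
`β ≥ 0` and for every compact `G`, STUB 0's clause is EQUIVALENT to the textbook absence of long-range order in the iterated-limit sense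

  `∀ A ∀ ε > 0 ∃ j₀ ∀ j ≥ j₀ ∃ S₀ ∀ S ≥ S₀, |D_A^{(S)}(j)| ≤ ε`   (i.e. `lim_{j→∞} limsup_{S→∞} |D_A^{(S)}(j)| = 0`),

in which the volume threshold may depend on the lag (`MirrorFixedLag.mirrorDecorrelation_iff_noLRO`; global form
`noMirrorLongRangeOrder_iff_noLRO`, registered `stub_stub0IffNoLRO`). So the promoted child `NoMirrorLongRangeOrder` has two faces: the
uniform one consumed by the line's composition, and the iterated-limit one that infinite-volume / DLR arguments produce.

* `MirrorFixedLag.mirrorSym_le` — `E_A^{(S)}(m) ≤ E_A^{(S)}(i)` for `2R+1 ≤ i ≤ m ≤ S` (the monotonicity, extracted);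
* `MirrorFixedLag.mirrorDecorrelation_of_noLRO` / `noLRO_of_mirrorDecorrelation` — the two directions at fixed `(G, r, β ≥ 0)`.

No definition is introduced; nothing here is a named fact; every compact `G`, every `β ≥ 0`. [folklore]
-/

noncomputable section

open MeasureTheory ProbabilityTheory Finset
open Literature.MathematicalPhysics.QuantumFieldTheory hiding Site ZdEdge
open Literature.MathematicalPhysics.QuantumLattice
open Literature.Probability.LatticeModels hiding configShift configShift_apply

namespace Summit.QuantumFields.YangMills.Theorems.FiniteSusceptibilityWeakCoupling

namespace MirrorFixedLag

open MirrorDominationAxis0 MirrorLogConvex MirrorMonotone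

variable {G : Type} [Group G] [TopologicalSpace G] [IsTopologicalGroup G] [CompactSpace G]
  [MeasurableSpace G] [BorelSpace G]

/-- **The symmetrised mirror function is non-increasing in the lag** (every compact `G`, `β ≥ 0`): with `R` bounding the time
extent of `supp A` and `supp Aᴿ` (`|t| + 2 ≤ R`), `D_A(m) + D_{Aᴿ}'(m) ≤ D_A(i) + D_{Aᴿ}'(i)` for `2R+1 ≤ i ≤ m ≤ S` on the torus
`2S+1`, where `D_{Aᴿ}'(m) = ⟨Aᴿ · τ_m A⟩ − ⟨Aᴿ⟩⟨A⟩ = D_A(2S+1−m)`. Positivity and step-one log-convexity (`…MirrorLogConvex`), symmetry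
(`mirrorCorr_fold`), `antitone_step_of_logConvex_symm`. [folklore] -/
theorem mirrorSym_le (r : LatticeRep G) {β : ℝ} (hβ : 0 ≤ β) (A : YMSpecies G) {R : ℕ}
    (hRA : ∀ e ∈ A.supp, (e.1 0).natAbs + 2 ≤ R) (hRR : ∀ e ∈ (reflSpecies A).supp, (e.1 0).natAbs + 2 ≤ R)
    {S i m : ℕ} (hi : 2 * R + 1 ≤ i) (him : i ≤ m) (hmS : m ≤ S) :
    latticeConnectedCorr r.ρ β (2 * S + 1) A.F (fun V => A.F (cfgReflect V)) m +
        latticeConnectedCorr r.ρ β (2 * S + 1) (fun V => A.F (cfgReflect V)) A.F m ≤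
      latticeConnectedCorr r.ρ β (2 * S + 1) A.F (fun V => A.F (cfgReflect V)) i +
        latticeConnectedCorr r.ρ β (2 * S + 1) (fun V => A.F (cfgReflect V)) A.F i := by
  obtain ⟨E, hE⟩ : ∃ E : ℕ → ℝ, ∀ n, E n =
      latticeConnectedCorr r.ρ β (2 * S + 1) A.F (fun V => A.F (cfgReflect V)) n +
        latticeConnectedCorr r.ρ β (2 * S + 1) (fun V => A.F (cfgReflect V)) A.F n := ⟨_, fun _ => rfl⟩
  have h0C : ∀ n, 2 * R + 1 ≤ n → n + 2 * R ≤ 2 * S →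
      0 ≤ latticeConnectedCorr r.ρ β (2 * S + 1) A.F (fun V => A.F (cfgReflect V)) n :=
    fun n h1 h2 => mirrorCorr_nonneg r hβ A hRA h1 h2
  have h0C' : ∀ n, 2 * R + 1 ≤ n → n + 2 * R ≤ 2 * S →
      0 ≤ latticeConnectedCorr r.ρ β (2 * S + 1) (fun V => A.F (cfgReflect V)) A.F n := fun n h1 h2 => by
    rw [← mirrorCorr_reflSpecies]; exact mirrorCorr_nonneg r hβ (reflSpecies A) hRR h1 h2
  have hlC : ∀ n, 2 * R + 2 ≤ n → n + 2 * R + 1 ≤ 2 * S →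
      latticeConnectedCorr r.ρ β (2 * S + 1) A.F (fun V => A.F (cfgReflect V)) n ^ 2 ≤
        latticeConnectedCorr r.ρ β (2 * S + 1) A.F (fun V => A.F (cfgReflect V)) (n - 1) *
          latticeConnectedCorr r.ρ β (2 * S + 1) A.F (fun V => A.F (cfgReflect V)) (n + 1) :=
    fun n h1 h2 => mirrorCorr_sq_le r hβ A hRA h1 h2
  have hlC' : ∀ n, 2 * R + 2 ≤ n → n + 2 * R + 1 ≤ 2 * S →
      latticeConnectedCorr r.ρ β (2 * S + 1) (fun V => A.F (cfgReflect V)) A.F n ^ 2 ≤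
        latticeConnectedCorr r.ρ β (2 * S + 1) (fun V => A.F (cfgReflect V)) A.F (n - 1) *
          latticeConnectedCorr r.ρ β (2 * S + 1) (fun V => A.F (cfgReflect V)) A.F (n + 1) :=
    fun n h1 h2 => by
      rw [← mirrorCorr_reflSpecies, ← mirrorCorr_reflSpecies, ← mirrorCorr_reflSpecies]
      exact mirrorCorr_sq_le r hβ (reflSpecies A) hRR h1 h2
  have h0E : ∀ n, 2 * R + 1 ≤ n → n + (2 * R + 1) ≤ 2 * S + 1 → 0 ≤ E n := fun n h1 h2 => by
    rw [hE]; exact add_nonneg (h0C n h1 (by omega)) (h0C' n h1 (by omega))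
  have hlE : ∀ n, 2 * R + 1 < n → n + (2 * R + 1) < 2 * S + 1 → E n ^ 2 ≤ E (n - 1) * E (n + 1) :=
    fun n h1 h2 => by
      rw [hE, hE, hE]
      exact add_sq_le_of_sq_le (hlC n (by omega) (by omega)) (hlC' n (by omega) (by omega))
        (h0C (n - 1) (by omega) (by omega)) (h0C (n + 1) (by omega) (by omega))
        (h0C' (n - 1) (by omega) (by omega)) (h0C' (n + 1) (by omega) (by omega))
  have hsE : ∀ n, n ≤ 2 * S + 1 → E (2 * S + 1 - n) = E n := fun n hn => by
    rw [hE, hE, mirrorCorr_fold' r β A hn, ← mirrorCorr_fold r β A hn, add_comm]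
  have h := le_of_antitone_step (antitone_step_of_logConvex_symm h0E hlE hsE) hi him hmS
  rwa [hE, hE] at h

/-- **Absence of long-range order (iterated limit) ⇒ mirror decorrelation uniform in volume and lag** (every compact `G`,
`β ≥ 0`). If for every species `A` and `ε > 0` there is `j₀` such that at every lag `j ≥ j₀` one has `|D_A^{(S)}(j)| ≤ ε` for all
LARGE ENOUGH volumes `S ≥ S₀(A, ε, j)`, then for every `A, ε` there is `j₀'` with `|D_A^{(S)}(j)| ≤ ε` for ALL `j₀' ≤ j ≤ S`: apply the
hypothesis to `A` and `Aᴿ` at one common lag `j⋆`, and propagate to all larger lags by `mirrorSym_le`; `j₀' = max(j⋆, S₀)`. [folklore] -/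
theorem mirrorDecorrelation_of_noLRO (r : LatticeRep G) {β : ℝ} (hβ : 0 ≤ β)
    (h : ∀ A : YMSpecies G, ∀ ε : ℝ, 0 < ε → ∃ j₀ : ℕ, ∀ j : ℕ, j₀ ≤ j → ∃ S₀ : ℕ, ∀ S : ℕ, S₀ ≤ S →
      |latticeConnectedCorr r.ρ β (2 * S + 1) A.F (fun V => A.F (cfgReflect V)) j| ≤ ε)
    (A : YMSpecies G) {ε : ℝ} (hε : 0 < ε) :
    ∃ j₀ : ℕ, ∀ S j : ℕ, j₀ ≤ j → j ≤ S →
      |latticeConnectedCorr r.ρ β (2 * S + 1) A.F (fun V => A.F (cfgReflect V)) j| ≤ ε := by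
  obtain ⟨R, hRA, hRA3⟩ : ∃ R : ℕ, (∀ e ∈ A.supp, (e.1 0).natAbs + 2 ≤ R) ∧
      ∀ e ∈ A.supp, (e.1 0).natAbs + (2 + 1) ≤ R := by
    refine ⟨(A.supp.sup fun e => (e.1 0).natAbs) + 3, fun e he => ?_, fun e he => ?_⟩ <;>
    · have := Finset.le_sup (f := fun e : ZdEdge 4 => (e.1 0).natAbs) he
      omega
  have hRR : ∀ e ∈ (reflSpecies A).supp, (e.1 0).natAbs + 2 ≤ R := radius_reflSpecies A (k := 2) hRA3
  have hε2 : 0 < ε / 2 := by positivity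
  obtain ⟨j₁, hj₁⟩ := h A (ε / 2) hε2
  obtain ⟨j₂, hj₂⟩ := h (reflSpecies A) (ε / 2) hε2
  obtain ⟨S₁, hS₁⟩ := hj₁ (max (2 * R + 1) (max j₁ j₂)) ((le_max_left _ _).trans (le_max_right _ _))
  obtain ⟨S₂, hS₂⟩ := hj₂ (max (2 * R + 1) (max j₁ j₂)) ((le_max_right _ _).trans (le_max_right _ _))
  refine ⟨max (max (2 * R + 1) (max j₁ j₂)) (max S₁ S₂), fun S j hj hjS => ?_⟩
  have hjs : max (2 * R + 1) (max j₁ j₂) ≤ j := (le_max_left _ _).trans hj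
  have hS1 : S₁ ≤ S := ((le_max_left _ _).trans ((le_max_right _ _).trans hj)).trans hjS
  have hS2 : S₂ ≤ S := ((le_max_right _ _).trans ((le_max_right _ _).trans hj)).trans hjS
  have hR1 : 2 * R + 1 ≤ max (2 * R + 1) (max j₁ j₂) := le_max_left _ _
  have hRj : 2 * R + 1 ≤ j := hR1.trans hjs
  have h1 := (le_abs_self _).trans (hS₁ S hS1)
  have h2 := (le_abs_self _).trans (hS₂ S hS2)
  rw [mirrorCorr_reflSpecies] at h2
  have hmono := mirrorSym_le r hβ A hRA hRR hR1 hjs hjS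
  have hCj : 0 ≤ latticeConnectedCorr r.ρ β (2 * S + 1) A.F (fun V => A.F (cfgReflect V)) j :=
    mirrorCorr_nonneg r hβ A hRA hRj (by omega)
  have hC'j : 0 ≤ latticeConnectedCorr r.ρ β (2 * S + 1) (fun V => A.F (cfgReflect V)) A.F j := by
    rw [← mirrorCorr_reflSpecies]; exact mirrorCorr_nonneg r hβ (reflSpecies A) hRR hRj (by omega)
  rw [abs_of_nonneg hCj]
  linarith

/-- The converse bookkeeping: uniform mirror decorrelation contains the iterated-limit statement (`S₀ := j`). [folklore] -/
theorem noLRO_of_mirrorDecorrelation (r : LatticeRep G) (β : ℝ)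
    (h : ∀ A : YMSpecies G, ∀ ε : ℝ, 0 < ε → ∃ j₀ : ℕ, ∀ S j : ℕ, j₀ ≤ j → j ≤ S →
      |latticeConnectedCorr r.ρ β (2 * S + 1) A.F (fun V => A.F (cfgReflect V)) j| ≤ ε)
    (A : YMSpecies G) {ε : ℝ} (hε : 0 < ε) :
    ∃ j₀ : ℕ, ∀ j : ℕ, j₀ ≤ j → ∃ S₀ : ℕ, ∀ S : ℕ, S₀ ≤ S →
      |latticeConnectedCorr r.ρ β (2 * S + 1) A.F (fun V => A.F (cfgReflect V)) j| ≤ ε := by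
  obtain ⟨j₀, hj₀⟩ := h A ε hε
  exact ⟨j₀, fun j hj => ⟨j, fun S hS => hj₀ S j hj hS⟩⟩

/-- **At fixed `(G, r, β ≥ 0)`: STUB 0's clause ⟺ absence of long-range order in the iterated-limit sense.** [folklore] -/
theorem mirrorDecorrelation_iff_noLRO (r : LatticeRep G) {β : ℝ} (hβ : 0 ≤ β) :
    (∀ A : YMSpecies G, ∀ ε : ℝ, 0 < ε → ∃ j₀ : ℕ, ∀ S j : ℕ, j₀ ≤ j → j ≤ S →
      |latticeConnectedCorr r.ρ β (2 * S + 1) A.F (fun V => A.F (cfgReflect V)) j| ≤ ε) ↔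
    (∀ A : YMSpecies G, ∀ ε : ℝ, 0 < ε → ∃ j₀ : ℕ, ∀ j : ℕ, j₀ ≤ j → ∃ S₀ : ℕ, ∀ S : ℕ, S₀ ≤ S →
      |latticeConnectedCorr r.ρ β (2 * S + 1) A.F (fun V => A.F (cfgReflect V)) j| ≤ ε) :=
  ⟨fun h A _ hε => noLRO_of_mirrorDecorrelation r β h A hε,
    fun h A _ hε => mirrorDecorrelation_of_noLRO r hβ h A hε⟩

end MirrorFixedLag

/-- **STUB 0 of line `purity-rate-split` ⟺ no mirror long-range order in the iterated-limit sense, at weak coupling** (global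
form; `β₀ ↦ max β₀ 0` in the backward direction, where reflection positivity is used). [folklore] -/
theorem noMirrorLongRangeOrder_iff_noLRO :
    (∀ (G : Type) [Group G] [TopologicalSpace G] [IsTopologicalGroup G] [CompactSpace G] [MeasurableSpace G]
      [BorelSpace G], IsCompactSimpleLieGroup G → ∀ r : LatticeRep G, ∃ β₀ : ℝ, ∀ β : ℝ, β₀ ≤ β →
      ∀ A : YMSpecies G, ∀ ε : ℝ, 0 < ε → ∃ j₀ : ℕ, ∀ S j : ℕ, j₀ ≤ j → j ≤ S →
        |latticeConnectedCorr r.ρ β (2 * S + 1) A.F (fun V => A.F (cfgReflect V)) j| ≤ ε) ↔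
    (∀ (G : Type) [Group G] [TopologicalSpace G] [IsTopologicalGroup G] [CompactSpace G] [MeasurableSpace G]
      [BorelSpace G], IsCompactSimpleLieGroup G → ∀ r : LatticeRep G, ∃ β₀ : ℝ, ∀ β : ℝ, β₀ ≤ β →
      ∀ A : YMSpecies G, ∀ ε : ℝ, 0 < ε → ∃ j₀ : ℕ, ∀ j : ℕ, j₀ ≤ j → ∃ S₀ : ℕ, ∀ S : ℕ, S₀ ≤ S →
        |latticeConnectedCorr r.ρ β (2 * S + 1) A.F (fun V => A.F (cfgReflect V)) j| ≤ ε) := by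
  constructor
  · intro h G _ _ _ _ _ _ hG r
    obtain ⟨β₀, hβ₀⟩ := h G hG r
    exact ⟨β₀, fun β hβ A ε hε => MirrorFixedLag.noLRO_of_mirrorDecorrelation r β (hβ₀ β hβ) A hε⟩
  · intro h G _ _ _ _ _ _ hG r
    obtain ⟨β₀, hβ₀⟩ := h G hG r
    refine ⟨max β₀ 0, fun β hβ A ε hε => ?_⟩
    exact MirrorFixedLag.mirrorDecorrelation_of_noLRO r ((le_max_right _ _).trans hβ)
      (hβ₀ β ((le_max_left _ _).trans hβ)) A hε

/-- **Registered sub-goal `stub_stub0IffNoLRO`** of item stmt-QuantumFields-9442 (signature verbatim, fully qualified): the registered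
STUB 0 `stub_noMirrorLongRangeOrder` of line `purity-rate-split` (mirror decorrelation uniform in volume AND lag) is EQUIVALENT to its
iterated-limit form (lag first, then volume) — the second, infinite-volume face of the promoted child `NoMirrorLongRangeOrder`. [folklore] -/
theorem stub_stub0IffNoLRO : (∀ (G : Type) [Group G] [TopologicalSpace G] [IsTopologicalGroup G] [CompactSpace G] [MeasurableSpace G] [BorelSpace G], Literature.MathematicalPhysics.QuantumFieldTheory.IsCompactSimpleLieGroup G → ∀ r : Literature.MathematicalPhysics.QuantumFieldTheory.LatticeRep G, ∃ β₀ : ℝ, ∀ β : ℝ, β₀ ≤ β → ∀ A : Literature.MathematicalPhysics.QuantumFieldTheory.YMSpecies G, ∀ ε : ℝ, 0 < ε → ∃ j₀ : ℕ, ∀ S j : ℕ, j₀ ≤ j → j ≤ S → |Literature.MathematicalPhysics.QuantumFieldTheory.latticeConnectedCorr r.ρ β (2 * S + 1) A.F (fun V => A.F (Literature.MathematicalPhysics.QuantumFieldTheory.cfgReflect V)) j| ≤ ε) ↔ (∀ (G : Type) [Group G] [TopologicalSpace G] [IsTopologicalGroup G] [CompactSpace G] [MeasurableSpace G] [BorelSpace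 G], Literature.MathematicalPhysics.QuantumFieldTheory.IsCompactSimpleLieGroup G → ∀ r : Literature.MathematicalPhysics.QuantumFieldTheory.LatticeRep G, ∃ β₀ : ℝ, ∀ β : ℝ, β₀ ≤ β → ∀ A : Literature.MathematicalPhysics.QuantumFieldTheory.YMSpecies G, ∀ ε : ℝ, 0 < ε → ∃ j₀ : ℕ, ∀ j : ℕ, j₀ ≤ j → ∃ S₀ : ℕ, ∀ S : ℕ, S₀ ≤ S → |Literature.MathematicalPhysics.QuantumFieldTheory.latticeConnectedCorr r.ρ β (2 * S + 1) A.F (fun V => A.F (Literature.MathematicalPhysics.QuantumFieldTheory.cfgReflect V)) j| ≤ ε) :=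
  noMirrorLongRangeOrder_iff_noLRO

end Summit.QuantumFields.YangMills.Theorems.FiniteSusceptibilityWeakCoupling

end
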